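import Summits.QuantumFields.YangMills.Theorems.UnitScaleTiltProp7Eq128AtMemberOfCrit127T3
import HarnessLib

/-!
# Route `UnitScaleTilt`, crux «MinimiserStabilityRegPr» (stmt-QuantumFields-19200, stub EX `stub_existenceMinimalOrbit`, route (α)) — «H128-TWO-SLOT»: **✓`Prop7Eq128AtMemberOfCrit127` (p677812)
# WITH THE FIELD DECOUPLED FROM THE OPERATOR SLOT** — EX namer ★w2-19200 g7's LOCATE «S11 SLOT WORD» (`LOCATE-S11-SLOTWORD-w2g7.md` 6b5b9573cc04df47, 19200 evidence #58) §4 ask: in S11 the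
# LETTERS `𝒢f∕H₁f` stay at `Δ_L := Δ₁ᴾ` (`DeltaOnePJ`) while print's (128) is read at the OPERATOR slot `Δ_x := Δ^η + T_Jᴾ` (`fun U₀ ↦ DeltaEtaSlot … U₀ + TJSlotP … U₀`); so the row
# `h128Δ : ∃ μ, Δ_x U₀ (toL2 (ιA₁ + ι(H₁f(Δ_L) B̃))) + (Ĵ + Ŵ) = Q_k† μ` needs the (127) ⇒ (128) door with TWO slots.  This file: §1 the (128)-pairing theorem for a FREE (115)-field `A′`;
# §2 the two-slot door `{ΔL Δx}` in the letters of ✓p678055 `Prop7HDsolAtRecordOfRowsTwoSlot.hΔsol_at_record_of_rows_twoSlot`'s `h128`; §3 its form at `U₀ ∈ 𝔘_k(ε₀)`.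

Cell `ym3-torus` (HUMAN RULING D-0037, YM ladder rung R3 — YM₃ on T³, NOT d = 4, NOT Clay; YM gap NOT proved), width seat `ym3-torus-px21` gen 3 (explicit-unit helper; lineage px21 g0∕g2∕g3).
THEOREMS ONLY (0 `def`, 0 `sorry`); `--supports stmt-QuantumFields-19200 --as helper`, count-neutral; NO claim on crux ∕ stub ∕ registry.

THE PRINT.  [Balaban1985Variational] p. 297 (127)–(128): the residual `J + Δ_aA′₁ + W(A′₁)` of the TRUE chart action is orthogonal to `ker Q`, hence `= Q*μ`; the field `A′₁ = A₁ + H₁B` is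
print's (102)–(103) p. 293 built with the `Δ₁`-propagators ((110) p. 294, [Balaban1985BackgroundPropagators] (3.127)–(3.128) p. 421), while `Δ_a = Δ + DRD* + Q*aQ` ((128), (3.26) p. 395)
is a DIFFERENT operator — two slots.  The proof is ✓p677812's verbatim (the forward chain of ✓`Prop7Crit93AtMemberOfRow84` reversed: (act) ✓`actionZ_chartCfg_eq_actionRe` + `hchart` ⇒
`HasDerivAt g ((η∕2)·S)`; `hXR` ⇒ `g = ↑f` near `0`; `hCrit` + uniqueness ⇒ `S = 0`; ✓`sum_pair27_eq_inner`; ✓`exists_eq_adjoint_Qk_of_hermitian_traceless`), with `A′` free.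
HONEST SCOPE.  Calculus glue + finite-dimensional linear algebra over landed letters; every estimate ∕ regime is displayed upstream (`hZ` ⟸ ✓`Prop7Row84AtEtaSlotMember`; `hchart`, `hXR` ⟸
✓`Prop7ChartConjPInv`-class; `hCrit127` ⟸ ✓`Prop7Crit127OfCrit93Split`); not a proof of any stub; nothing continuum ∕ OS ∕ mass-gap ∕ Clay.
-/

set_option autoImplicit false

noncomputable section

open scoped InnerProductSpace ComplexConjugate Matrix.Norms.L2Operator BigOperators Topology
open Complex (I)

namespace Summit.QuantumFields.YangMills.Theorems.Prop7Eq128AtMemberOfCrit127TwoSlot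

open Literature.MathematicalPhysics.QuantumFieldTheory.Balaban1983to89
open Literature.MathematicalPhysics.QuantumFieldTheory.Balaban1983to89.T3ContinuumYM3Torus
open NormedSpace (exp)
open T3PrintedRegularMinimiser (RegPr)
open B9SectCLatticeCarrier (Bond)
open B9Eq311L2Pairing (WL2)
open B11Eq115Space (NegSize Space115 JetSup NegSup)
open B11Eq111FrakG (nabla115)
open B11Eq103H1Complex (SiteL2K BondL2K funEquiv)
open B11Eq98CurrentSlot (Jcur)
open B11Eq90Transpose (pair27)
open B11Eq90V0primeCurrent (Tsh Ucur curL flat115 flat115_apply)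
open B9Eq3119DeltaPiCarrier (currentCLM)
open B9Eq39Adjoint (prodCfg)
open B9Eq31ActionZpow (actionZ)
open T3SectALandauChart (eta emb15 bgUnits)
open Summit.QuantumFields.YangMills.Theorems.Prop7TPrint (expHermField)
open Summit.QuantumFields.YangMills.Theorems.Prop7SectET3Transport (periodsT3 bondEquiv bgOfCfg)
open Summit.QuantumFields.YangMills.Theorems.Prop7SectET3HilbertLetters (W₂ frobEquiv toL2 DL2 DstarL2)
open Summit.QuantumFields.YangMills.Theorems.Prop7SectET3CurvedPropagators
open Summit.QuantumFields.YangMills.Theorems.Prop7SymAvgTwSym (QTwS QTwS_star_comm_of_regPr QTwS_scalar_of_regPr QTwS_traceless_of_regPr)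
open Summit.QuantumFields.YangMills.Theorems.Prop7SectET3WilsonHessian (chartU actionRe actionRe_bgUnits bgUnits_emb15_expHermField)
open Summit.QuantumFields.YangMills.Theorems.Prop7Crit93OfEq111 (sum_pair27_eq_inner)
open Summit.QuantumFields.YangMills.Theorems.Prop7ActionLatticeTransport (actionZ_chartCfg_eq_actionRe)
open Summit.QuantumFields.YangMills.Theorems.Prop7HermDensity (exists_eq_adjoint_Qk_of_hermitian_traceless)
open Summit.QuantumFields.YangMills.Theorems.Prop7Eq128AtMemberOfCrit127 (actionRe_chartU_eq_ofReal_of_real)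

variable {F : T3Family} {n K : ℕ} {h : n ≤ K} {c₀ cB a : ℝ} [Fact (0 < c₀)] [Fact (0 < cB)]
  {Δx : GaugeField (F.P K) 0 (Matrix.specialUnitaryGroup (Fin 2) ℂ) → (BondL2K ℂ 3 (periodsT3 F K) c₀ W₂ →ₗ[ℂ] BondL2K ℂ 3 (periodsT3 F K) c₀ W₂)}
  [Fact (0 < (F.L : ℝ))] [Fact (0 < ((F.L : ℝ)⁻¹) ^ (K - n))]

/-! ## §1 ★★★ (128) in pairing form at ONE direction, FREE field `A′` -/

/-- ★★★ **(128) IN PAIRING FORM AT ONE DIRECTION, FREE (115)-FIELD `A′`** (generic slot `Δx`, chart `χ`, letters `W`, `Tc`): ✓`Prop7Eq128AtMemberOfCrit127.inner_toL2_residual_eq_zero_of_hCrit127_of_hasDerivAt_actionZ`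
with the knit's `A₁ + H₁f B` replaced by an arbitrary `A′` (`X := κ_f • ιA′`).  Rows at `δ′`: `hZ` (lit (84)), `hchart`, `hXR` (near `0`), `hCrit` (= `hCrit127` at `δ := κ_f • ιδ′`).  Conclusion:
`⟪toL2 ιδ′, Δx U₀ (toL2 ιA′) + funEquiv⁻¹(NegSup.equiv J + NegSup.equiv (W A′))⟫_ℂ = 0`. [cite: Balaban1985Variational, (127)–(128) p.297, (84) p.290; Balaban1985BackgroundPropagators, (3.1) p.390, (3.6)–(3.7) p.391] -/
theorem inner_toL2_residual_eq_zero_of_hCrit127_of_hasDerivAt_actionZ_field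
    (U₀ : GaugeField (F.P K) 0 (Matrix.specialUnitaryGroup (Fin 2) ℂ))
    (A' : Space115 (F.L : ℝ) (((F.L : ℝ)⁻¹) ^ (K - n)) (fun _ : Bond 3 (periodsT3 F K) => K - n) (fun _ : Bond 3 (periodsT3 F K) × Fin 3 => K - n)
      (nabla115 (((F.L : ℝ)⁻¹) ^ (K - n)) (bgOfCfg F K U₀)))
    (W : Space115 (F.L : ℝ) (((F.L : ℝ)⁻¹) ^ (K - n)) (fun _ : Bond 3 (periodsT3 F K) => K - n) (fun _ : Bond 3 (periodsT3 F K) × Fin 3 => K - n)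
        (nabla115 (((F.L : ℝ)⁻¹) ^ (K - n)) (bgOfCfg F K U₀)) →
      NegSize (F.L : ℝ) (((F.L : ℝ)⁻¹) ^ (K - n)) (fun _ : Bond 3 (periodsT3 F K) => K - n) 3 (Matrix (Fin 2) (Fin 2) ℂ))
    (Tc : Space115 (F.L : ℝ) (((F.L : ℝ)⁻¹) ^ (K - n)) (fun _ : Bond 3 (periodsT3 F K) => K - n) (fun _ : Bond 3 (periodsT3 F K) × Fin 3 => K - n)
        (nabla115 (((F.L : ℝ)⁻¹) ^ (K - n)) (bgOfCfg F K U₀)) →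
      Space115 (F.L : ℝ) (((F.L : ℝ)⁻¹) ^ (K - n)) (fun _ : Bond 3 (periodsT3 F K) => K - n) (fun _ : Bond 3 (periodsT3 F K) × Fin 3 => K - n)
        (nabla115 (((F.L : ℝ)⁻¹) ^ (K - n)) (bgOfCfg F K U₀)))
    (χ : (PBond (F.P K) 0 → Matrix (Fin 2) (Fin 2) ℂ) → (PBond (F.P K) 0 → Matrix (Fin 2) (Fin 2) ℂ))
    {δ' : Space115 (F.L : ℝ) (((F.L : ℝ)⁻¹) ^ (K - n)) (fun _ : Bond 3 (periodsT3 F K) => K - n) (fun _ : Bond 3 (periodsT3 F K) × Fin 3 => K - n)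
      (nabla115 (((F.L : ℝ)⁻¹) ^ (K - n)) (bgOfCfg F K U₀))}
    (hδR : ∀ b : PBond (F.P K) 0, star (JetSup.equiv _ _ _ δ' (bondEquiv F K b)) = JetSup.equiv _ _ _ δ' (bondEquiv F K b))
    (hZ : HasDerivAt (fun t : ℝ => actionZ Tsh (((F.L : ℝ)⁻¹) ^ (K - n)) 3
        ((LinearMap.toContinuousLinearMap (Matrix.traceLinearMap (Fin 2) ℂ ℂ) : Matrix (Fin 2) (Fin 2) ℂ →L[ℂ] ℂ) : Matrix (Fin 2) (Fin 2) ℂ →ₗ[ℂ] ℂ)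
        (prodCfg (Ucur (bgOfCfg F K U₀)) (((F.L : ℝ)⁻¹) ^ (K - n)) (curL (flat115 (Tc (A' + (t : ℂ) • δ'))))))
      (pair27 (LinearMap.toContinuousLinearMap (Matrix.traceLinearMap (Fin 2) ℂ ℂ)) (Jcur (bgOfCfg F K U₀) : NegSize (F.L : ℝ) (((F.L : ℝ)⁻¹) ^ (K - n)) (fun _ : Bond 3 (periodsT3 F K) => K - n) 3 (Matrix (Fin 2) (Fin 2) ℂ)) (flat115 δ')
        + pair27 (LinearMap.toContinuousLinearMap (Matrix.traceLinearMap (Fin 2) ℂ ℂ))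
            (currentCLM frobEquiv (fun _ : Bond 3 (periodsT3 F K) × Fin 3 => K - n) (nabla115 (((F.L : ℝ)⁻¹) ^ (K - n)) (bgOfCfg F K U₀)) (Δx U₀) (A'))
            (flat115 δ')
        + pair27 (LinearMap.toContinuousLinearMap (Matrix.traceLinearMap (Fin 2) ℂ ℂ)) (W (A')) (flat115 δ')) 0)
    (hchart : ∀ᶠ t : ℝ in nhds 0,
      ((((eta F n K : ℝ) : ℂ)) * Complex.I) • (fun b : PBond (F.P K) 0 => JetSup.equiv _ _ _ (Tc (A' + (t : ℂ) • δ')) (bondEquiv F K b))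
        = χ (((((eta F n K : ℝ) : ℂ)) * Complex.I) • (fun b : PBond (F.P K) 0 => JetSup.equiv _ _ _ A' (bondEquiv F K b))
            + (t : ℂ) • (((((eta F n K : ℝ) : ℂ)) * Complex.I) • fun b : PBond (F.P K) 0 => JetSup.equiv _ _ _ δ' (bondEquiv F K b))))
    (hXR : ∀ᶠ t : ℝ in nhds 0, ∀ b' : PBond (F.P K) 0,
      (((-Complex.I) • χ (((((eta F n K : ℝ) : ℂ)) * Complex.I) • (fun b : PBond (F.P K) 0 => JetSup.equiv _ _ _ A' (bondEquiv F K b))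
            + (t : ℂ) • (((((eta F n K : ℝ) : ℂ)) * Complex.I) • fun b : PBond (F.P K) 0 => JetSup.equiv _ _ _ δ' (bondEquiv F K b)))) b').IsHermitian ∧
      Matrix.trace (((-Complex.I) • χ (((((eta F n K : ℝ) : ℂ)) * Complex.I) • (fun b : PBond (F.P K) 0 => JetSup.equiv _ _ _ A' (bondEquiv F K b))
            + (t : ℂ) • (((((eta F n K : ℝ) : ℂ)) * Complex.I) • fun b : PBond (F.P K) 0 => JetSup.equiv _ _ _ δ' (bondEquiv F K b)))) b') = 0)
    (hCrit : deriv (fun t : ℝ => wilsonAction4 (emb15 U₀ (expHermField (fun b' : PBond (F.P K) 0 => (-Complex.I) •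
      (χ (((((eta F n K : ℝ) : ℂ)) * Complex.I) • (fun b : PBond (F.P K) 0 => JetSup.equiv _ _ _ A' (bondEquiv F K b))
        + (t : ℂ) • (((((eta F n K : ℝ) : ℂ)) * Complex.I) • fun b : PBond (F.P K) 0 => JetSup.equiv _ _ _ δ' (bondEquiv F K b)))) b')))) 0 = 0) :
    ⟪toL2 F K c₀ (fun b : PBond (F.P K) 0 => JetSup.equiv _ _ _ δ' (bondEquiv F K b)),
      Δx U₀ (toL2 F K c₀ (fun b : PBond (F.P K) 0 => JetSup.equiv _ _ _ A' (bondEquiv F K b)))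
        + (funEquiv frobEquiv (fun _ : Bond 3 (periodsT3 F K) => c₀)).symm
            (NegSup.equiv _ _ (Jcur (L := (F.L : ℝ)) (η := ((F.L : ℝ)⁻¹) ^ (K - n)) (lev₀ := fun _ : Bond 3 (periodsT3 F K) => K - n) (bgOfCfg F K U₀))
              + NegSup.equiv _ _ (W (A')))⟫_ℂ = 0 := by
  -- abbreviations
  set X : PBond (F.P K) 0 → Matrix (Fin 2) (Fin 2) ℂ := ((((eta F n K : ℝ) : ℂ)) * Complex.I) •
    (fun b : PBond (F.P K) 0 => JetSup.equiv _ _ _ A' (bondEquiv F K b))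
    with hX
  set δ : PBond (F.P K) 0 → Matrix (Fin 2) (Fin 2) ℂ := ((((eta F n K : ℝ) : ℂ)) * Complex.I) • fun b : PBond (F.P K) 0 => JetSup.equiv _ _ _ δ' (bondEquiv F K b) with hδ
  set g : ℝ → ℂ := fun t => actionRe F K (chartU F K U₀ (χ (X + (t : ℂ) • δ))) with hg
  set f : ℝ → ℝ := fun t => wilsonAction4 (emb15 U₀ (expHermField (fun b' : PBond (F.P K) 0 => (-Complex.I) • (χ (X + (t : ℂ) • δ)) b'))) with hfdef
  set S : ℂ := pair27 (LinearMap.toContinuousLinearMap (Matrix.traceLinearMap (Fin 2) ℂ ℂ)) (Jcur (bgOfCfg F K U₀) : NegSize (F.L : ℝ) (((F.L : ℝ)⁻¹) ^ (K - n)) (fun _ : Bond 3 (periodsT3 F K) => K - n) 3 (Matrix (Fin 2) (Fin 2) ℂ)) (flat115 δ')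
        + pair27 (LinearMap.toContinuousLinearMap (Matrix.traceLinearMap (Fin 2) ℂ ℂ))
            (currentCLM frobEquiv (fun _ : Bond 3 (periodsT3 F K) × Fin 3 => K - n) (nabla115 (((F.L : ℝ)⁻¹) ^ (K - n)) (bgOfCfg F K U₀)) (Δx U₀) (A'))
            (flat115 δ')
        + pair27 (LinearMap.toContinuousLinearMap (Matrix.traceLinearMap (Fin 2) ℂ ℂ)) (W (A')) (flat115 δ') with hS
  have hηpos : (0 : ℝ) < eta F n K := T3SectALandauChart.eta_pos F n K
  have hηne : (((eta F n K : ℝ) : ℂ)) ≠ 0 := Complex.ofReal_ne_zero.2 hηpos.ne'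
  -- (act) + hchart: near `t = 0`, lit's `actionZ` along the lattice ray is `η⁻¹·2·g t`
  have hZ' : HasDerivAt (fun t : ℝ => (((eta F n K : ℝ) : ℂ))⁻¹ * (2 * g t)) S 0 := by
    refine hZ.congr_of_eventuallyEq ?_
    filter_upwards [hchart] with t ht
    have hact := actionZ_chartCfg_eq_actionRe (F := F) (K := K) U₀ (eta F n K) (Tc (A' + (t : ℂ) • δ'))
    rw [ht] at hact
    exact hact.symm
  -- undo the constant `2η⁻¹`
  have hg' := hZ'.const_mul ((((eta F n K : ℝ) : ℂ)) / 2)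
  have hgfun : (fun t : ℝ => (((eta F n K : ℝ) : ℂ)) / 2 * ((((eta F n K : ℝ) : ℂ))⁻¹ * (2 * g t))) = g := by
    funext t
    field_simp
  rw [hgfun] at hg'
  -- reality near `0`: `g = (f : ℝ) ↪ ℂ`
  have hgf : g =ᶠ[nhds 0] fun t : ℝ => ((f t : ℝ) : ℂ) := by
    filter_upwards [hXR] with t ht
    exact actionRe_chartU_eq_ofReal_of_real U₀ ht
  -- so `f = re ∘ g` near `0` has derivative `re((η∕2)·S)`, and `g` has the REAL derivative `↑(re((η∕2)·S))`
  have hf : HasDerivAt f (RCLike.re ((((eta F n K : ℝ) : ℂ)) / 2 * S)) 0 := by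
    have hre := (Complex.reCLM.hasFDerivAt.comp_hasDerivAt (0 : ℝ) hg')
    refine (hre.congr_of_eventuallyEq ?_)
    filter_upwards [hgf] with t ht
    simp only [Function.comp_def, Complex.reCLM_apply, ht, Complex.ofReal_re]
  have hgR : HasDerivAt g ((((RCLike.re ((((eta F n K : ℝ) : ℂ)) / 2 * S)) : ℝ) : ℂ)) 0 := (hf.ofReal_comp).congr_of_eventuallyEq hgf
  -- (127): `deriv f 0 = 0`, so `(η∕2)·S = ↑(re((η∕2)·S)) = 0`
  have hre0 : RCLike.re ((((eta F n K : ℝ) : ℂ)) / 2 * S) = 0 := by rw [← hf.deriv]; exact hCrit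
  have hS0 : S = 0 := by
    have h := hg'.unique hgR
    rw [hre0] at h
    have h2 : (((eta F n K : ℝ) : ℂ)) / 2 ≠ 0 := div_ne_zero hηne two_ne_zero
    simpa [h2] using h
  -- the (84) sum in `L²` letters
  have hstar : star (fun b : PBond (F.P K) 0 => JetSup.equiv _ _ _ δ' (bondEquiv F K b)) = fun b : PBond (F.P K) 0 => JetSup.equiv _ _ _ δ' (bondEquiv F K b) :=
    funext fun b => hδR b
  have hsum := sum_pair27_eq_inner (c₀ := c₀) U₀ (Δx U₀) (Jcur (bgOfCfg F K U₀)) (W (A')) (A') δ'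
  rw [← hS, hS0, hstar] at hsum
  have hc : (c₀ : ℂ)⁻¹ ≠ 0 := inv_ne_zero (Complex.ofReal_ne_zero.2 (Fact.out : 0 < c₀).ne')
  have hη3 : ((((F.L : ℝ)⁻¹) ^ (K - n) : ℝ) : ℂ) ^ 3 ≠ 0 := pow_ne_zero 3 hηne
  have hinner := (mul_eq_zero.1 hsum.symm).resolve_left hη3
  have hinner' := (mul_eq_zero.1 hinner).resolve_left hc
  rw [add_comm]
  exact hinner'

/-! ## §2 ★★★ The two-slot door: letters at `Δ_L`, operator at `Δ_x` (EX namer's SLOT WORD) -/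

/-- ★★★ **S11's ROW `h128Δ` AT THE T³ MEMBER, TWO SLOTS** — ✓`exists_eq_adjoint_Qk_of_hCrit127_of_hasDerivAt_actionZ` with the `H₁f` LETTER at `ΔL` (S11: `DeltaOnePJ`) and the (128) OPERATOR at
`Δx` (S11: `fun U₀ ↦ DeltaEtaSlot … U₀ + TJSlotP … U₀`): rows ∀ Hermitian-traceless `ιδ′ ∈ ker QTwS` (`hZ` = ✓`Prop7Row84AtEtaSlotMember.hasDerivAt_actionZ_chartRay_real_member_eta` at
`A′ := A₁ + H₁f(Δ_L) B̃`; `hchart` = ✓`Prop7ChartConjPInv.eventually_smul_iota_T47_eq_chart_pinv` at `Z := H₁f(Δ_L) B̃`; `hXR`), `hCrit127` (✓`hCrit127_of_hCrit93_of_split127`'s conclusion at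
`X := κ_f • (ιA₁ + ι(H₁f(Δ_L) B̃))`), sectors `hQ hQtr hQsc`, `hXtr`.  Conclusion = ✓p678055's `h128` text: `∃ μ, Δx U₀ (toL2 (ιA₁ + ι(H₁f(Δ_L) B))) + funEquiv⁻¹(NegSup.equiv (Jcur (bgOfCfg U₀)) +
NegSup.equiv (W (A₁ + H₁f(Δ_L) B))) = Q_k† μ`. [cite: Balaban1985Variational, (127)–(128) p.297, (129)–(130) pp.297–298, (102)–(103) p.293, (84) p.290, (51) p.286; Balaban1985BackgroundPropagators, (3.26) p.395, (3.127)–(3.128) p.421, (3.13)–(3.15) p.393] -/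
theorem exists_eq_adjoint_Qk_of_hCrit127_of_hasDerivAt_actionZ_twoSlot
    {ΔL : GaugeField (F.P K) 0 (Matrix.specialUnitaryGroup (Fin 2) ℂ) → (BondL2K ℂ 3 (periodsT3 F K) c₀ W₂ →ₗ[ℂ] BondL2K ℂ 3 (periodsT3 F K) c₀ W₂)}
    (U₀ : GaugeField (F.P K) 0 (Matrix.specialUnitaryGroup (Fin 2) ℂ))
    (hQ : ∀ A : PBond (F.P K) 0 → Matrix (Fin 2) (Fin 2) ℂ, QTwS F n K h U₀ (star A) = star (QTwS F n K h U₀ A))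
    (hQtr : ∀ A : PBond (F.P K) 0 → Matrix (Fin 2) (Fin 2) ℂ, (∀ b, (A b).trace = 0) → ∀ c, (QTwS F n K h U₀ A c).trace = 0)
    (hQsc : ∀ c : PBond (F.P K) 0 → ℂ, ∃ d : PBond (F.P n) 0 → ℂ, QTwS F n K h U₀ (fun b => c b • (1 : Matrix (Fin 2) (Fin 2) ℂ)) = fun c' => d c' • 1)
    (A₁ : Space115 (F.L : ℝ) (((F.L : ℝ)⁻¹) ^ (K - n)) (fun _ : Bond 3 (periodsT3 F K) => K - n) (fun _ : Bond 3 (periodsT3 F K) × Fin 3 => K - n)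
      (nabla115 (((F.L : ℝ)⁻¹) ^ (K - n)) (bgOfCfg F K U₀)))
    (W : Space115 (F.L : ℝ) (((F.L : ℝ)⁻¹) ^ (K - n)) (fun _ : Bond 3 (periodsT3 F K) => K - n) (fun _ : Bond 3 (periodsT3 F K) × Fin 3 => K - n)
        (nabla115 (((F.L : ℝ)⁻¹) ^ (K - n)) (bgOfCfg F K U₀)) →
      NegSize (F.L : ℝ) (((F.L : ℝ)⁻¹) ^ (K - n)) (fun _ : Bond 3 (periodsT3 F K) => K - n) 3 (Matrix (Fin 2) (Fin 2) ℂ))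
    (Tc : Space115 (F.L : ℝ) (((F.L : ℝ)⁻¹) ^ (K - n)) (fun _ : Bond 3 (periodsT3 F K) => K - n) (fun _ : Bond 3 (periodsT3 F K) × Fin 3 => K - n)
        (nabla115 (((F.L : ℝ)⁻¹) ^ (K - n)) (bgOfCfg F K U₀)) →
      Space115 (F.L : ℝ) (((F.L : ℝ)⁻¹) ^ (K - n)) (fun _ : Bond 3 (periodsT3 F K) => K - n) (fun _ : Bond 3 (periodsT3 F K) × Fin 3 => K - n)
        (nabla115 (((F.L : ℝ)⁻¹) ^ (K - n)) (bgOfCfg F K U₀)))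
    (B : PBond (F.P n) 0 → Matrix (Fin 2) (Fin 2) ℂ)
    (χ : (PBond (F.P K) 0 → Matrix (Fin 2) (Fin 2) ℂ) → (PBond (F.P K) 0 → Matrix (Fin 2) (Fin 2) ℂ))
    (hZ : ∀ δ' : Space115 (F.L : ℝ) (((F.L : ℝ)⁻¹) ^ (K - n)) (fun _ : Bond 3 (periodsT3 F K) => K - n) (fun _ : Bond 3 (periodsT3 F K) × Fin 3 => K - n)
        (nabla115 (((F.L : ℝ)⁻¹) ^ (K - n)) (bgOfCfg F K U₀)),
      (∀ b : PBond (F.P K) 0, star (JetSup.equiv _ _ _ δ' (bondEquiv F K b)) = JetSup.equiv _ _ _ δ' (bondEquiv F K b)) →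
      (∀ b : PBond (F.P K) 0, Matrix.trace (JetSup.equiv _ _ _ δ' (bondEquiv F K b)) = 0) →
      QTwS F n K h U₀ (fun b : PBond (F.P K) 0 => JetSup.equiv _ _ _ δ' (bondEquiv F K b)) = 0 →
      HasDerivAt (fun t : ℝ => actionZ Tsh (((F.L : ℝ)⁻¹) ^ (K - n)) 3
        ((LinearMap.toContinuousLinearMap (Matrix.traceLinearMap (Fin 2) ℂ ℂ) : Matrix (Fin 2) (Fin 2) ℂ →L[ℂ] ℂ) : Matrix (Fin 2) (Fin 2) ℂ →ₗ[ℂ] ℂ)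
        (prodCfg (Ucur (bgOfCfg F K U₀)) (((F.L : ℝ)⁻¹) ^ (K - n)) (curL (flat115 (Tc (A₁ + H1f F n K h c₀ cB a ΔL U₀ B + (t : ℂ) • δ'))))))
      (pair27 (LinearMap.toContinuousLinearMap (Matrix.traceLinearMap (Fin 2) ℂ ℂ)) (Jcur (bgOfCfg F K U₀) : NegSize (F.L : ℝ) (((F.L : ℝ)⁻¹) ^ (K - n)) (fun _ : Bond 3 (periodsT3 F K) => K - n) 3 (Matrix (Fin 2) (Fin 2) ℂ)) (flat115 δ')
        + pair27 (LinearMap.toContinuousLinearMap (Matrix.traceLinearMap (Fin 2) ℂ ℂ))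
            (currentCLM frobEquiv (fun _ : Bond 3 (periodsT3 F K) × Fin 3 => K - n) (nabla115 (((F.L : ℝ)⁻¹) ^ (K - n)) (bgOfCfg F K U₀)) (Δx U₀) (A₁ + H1f F n K h c₀ cB a ΔL U₀ B))
            (flat115 δ')
        + pair27 (LinearMap.toContinuousLinearMap (Matrix.traceLinearMap (Fin 2) ℂ ℂ)) (W (A₁ + H1f F n K h c₀ cB a ΔL U₀ B)) (flat115 δ')) 0)
    (hchart : ∀ δ' : Space115 (F.L : ℝ) (((F.L : ℝ)⁻¹) ^ (K - n)) (fun _ : Bond 3 (periodsT3 F K) => K - n) (fun _ : Bond 3 (periodsT3 F K) × Fin 3 => K - n)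
        (nabla115 (((F.L : ℝ)⁻¹) ^ (K - n)) (bgOfCfg F K U₀)),
      (∀ b : PBond (F.P K) 0, star (JetSup.equiv _ _ _ δ' (bondEquiv F K b)) = JetSup.equiv _ _ _ δ' (bondEquiv F K b)) →
      (∀ b : PBond (F.P K) 0, Matrix.trace (JetSup.equiv _ _ _ δ' (bondEquiv F K b)) = 0) →
      QTwS F n K h U₀ (fun b : PBond (F.P K) 0 => JetSup.equiv _ _ _ δ' (bondEquiv F K b)) = 0 →
      ∀ᶠ t : ℝ in nhds 0,
        ((((eta F n K : ℝ) : ℂ)) * Complex.I) • (fun b : PBond (F.P K) 0 => JetSup.equiv _ _ _ (Tc (A₁ + H1f F n K h c₀ cB a ΔL U₀ B + (t : ℂ) • δ')) (bondEquiv F K b))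
          = χ (((((eta F n K : ℝ) : ℂ)) * Complex.I) • ((fun b : PBond (F.P K) 0 => JetSup.equiv _ _ _ A₁ (bondEquiv F K b))
                + (fun b : PBond (F.P K) 0 => JetSup.equiv _ _ _ (H1f F n K h c₀ cB a ΔL U₀ B) (bondEquiv F K b)))
              + (t : ℂ) • (((((eta F n K : ℝ) : ℂ)) * Complex.I) • fun b : PBond (F.P K) 0 => JetSup.equiv _ _ _ δ' (bondEquiv F K b))))
    (hXR : ∀ δ' : Space115 (F.L : ℝ) (((F.L : ℝ)⁻¹) ^ (K - n)) (fun _ : Bond 3 (periodsT3 F K) => K - n) (fun _ : Bond 3 (periodsT3 F K) × Fin 3 => K - n)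
        (nabla115 (((F.L : ℝ)⁻¹) ^ (K - n)) (bgOfCfg F K U₀)),
      (∀ b : PBond (F.P K) 0, star (JetSup.equiv _ _ _ δ' (bondEquiv F K b)) = JetSup.equiv _ _ _ δ' (bondEquiv F K b)) →
      (∀ b : PBond (F.P K) 0, Matrix.trace (JetSup.equiv _ _ _ δ' (bondEquiv F K b)) = 0) →
      QTwS F n K h U₀ (fun b : PBond (F.P K) 0 => JetSup.equiv _ _ _ δ' (bondEquiv F K b)) = 0 →
      ∀ᶠ t : ℝ in nhds 0, ∀ b' : PBond (F.P K) 0,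
        (((-Complex.I) • χ (((((eta F n K : ℝ) : ℂ)) * Complex.I) • ((fun b : PBond (F.P K) 0 => JetSup.equiv _ _ _ A₁ (bondEquiv F K b))
                + (fun b : PBond (F.P K) 0 => JetSup.equiv _ _ _ (H1f F n K h c₀ cB a ΔL U₀ B) (bondEquiv F K b)))
              + (t : ℂ) • (((((eta F n K : ℝ) : ℂ)) * Complex.I) • fun b : PBond (F.P K) 0 => JetSup.equiv _ _ _ δ' (bondEquiv F K b)))) b').IsHermitian ∧
        Matrix.trace (((-Complex.I) • χ (((((eta F n K : ℝ) : ℂ)) * Complex.I) • ((fun b : PBond (F.P K) 0 => JetSup.equiv _ _ _ A₁ (bondEquiv F K b))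
                + (fun b : PBond (F.P K) 0 => JetSup.equiv _ _ _ (H1f F n K h c₀ cB a ΔL U₀ B) (bondEquiv F K b)))
              + (t : ℂ) • (((((eta F n K : ℝ) : ℂ)) * Complex.I) • fun b : PBond (F.P K) 0 => JetSup.equiv _ _ _ δ' (bondEquiv F K b)))) b') = 0)
    (hCrit127 : ∀ δ : PBond (F.P K) 0 → Matrix (Fin 2) (Fin 2) ℂ, (∀ b', star (δ b') = -δ b' ∧ (δ b').trace = 0) → QTwS F n K h U₀ δ = 0 →
      deriv (fun t : ℝ => wilsonAction4 (emb15 U₀ (expHermField (fun b' : PBond (F.P K) 0 => (-Complex.I) •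
        (χ (((((eta F n K : ℝ) : ℂ)) * Complex.I) • ((fun b : PBond (F.P K) 0 => JetSup.equiv _ _ _ A₁ (bondEquiv F K b))
            + (fun b : PBond (F.P K) 0 => JetSup.equiv _ _ _ (H1f F n K h c₀ cB a ΔL U₀ B) (bondEquiv F K b)))
          + (t : ℂ) • δ)) b')))) 0 = 0)
    (hXtr : ∀ b : PBond (F.P K) 0, Matrix.trace ((toL2 F K c₀).symm
      (Δx U₀ (toL2 F K c₀ ((fun b : PBond (F.P K) 0 => JetSup.equiv _ _ _ A₁ (bondEquiv F K b))
          + (fun b : PBond (F.P K) 0 => JetSup.equiv _ _ _ (H1f F n K h c₀ cB a ΔL U₀ B) (bondEquiv F K b))))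
        + (funEquiv frobEquiv (fun _ : Bond 3 (periodsT3 F K) => c₀)).symm
            (NegSup.equiv _ _ (Jcur (L := (F.L : ℝ)) (η := ((F.L : ℝ)⁻¹) ^ (K - n)) (lev₀ := fun _ : Bond 3 (periodsT3 F K) => K - n) (bgOfCfg F K U₀))
              + NegSup.equiv _ _ (W (A₁ + H1f F n K h c₀ cB a ΔL U₀ B)))) b) = 0) :
    ∃ μ : WL2 ℂ (fun _ : PBond (F.P n) 0 => cB) W₂,
      Δx U₀ (toL2 F K c₀ ((fun b : PBond (F.P K) 0 => JetSup.equiv _ _ _ A₁ (bondEquiv F K b))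
          + (fun b : PBond (F.P K) 0 => JetSup.equiv _ _ _ (H1f F n K h c₀ cB a ΔL U₀ B) (bondEquiv F K b))))
        + (funEquiv frobEquiv (fun _ : Bond 3 (periodsT3 F K) => c₀)).symm
            (NegSup.equiv _ _ (Jcur (L := (F.L : ℝ)) (η := ((F.L : ℝ)⁻¹) ^ (K - n)) (lev₀ := fun _ : Bond 3 (periodsT3 F K) => K - n) (bgOfCfg F K U₀))
              + NegSup.equiv _ _ (W (A₁ + H1f F n K h c₀ cB a ΔL U₀ B)))
      = LinearMap.adjoint (Qk F n K h c₀ cB U₀) μ := by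
  refine exists_eq_adjoint_Qk_of_hermitian_traceless U₀ hQ hQtr hQsc hXtr fun aH haR hatr haQ => ?_
  -- read the route direction `aH` as the (115)-direction `δ′ := aH ∘ bondEquiv⁻¹`
  set δ' : Space115 (F.L : ℝ) (((F.L : ℝ)⁻¹) ^ (K - n)) (fun _ : Bond 3 (periodsT3 F K) => K - n) (fun _ : Bond 3 (periodsT3 F K) × Fin 3 => K - n)
      (nabla115 (((F.L : ℝ)⁻¹) ^ (K - n)) (bgOfCfg F K U₀)) := fun p => aH ((bondEquiv F K).symm p) with hδ'
  have hι : (fun b : PBond (F.P K) 0 => JetSup.equiv _ _ _ δ' (bondEquiv F K b)) = aH := by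
    funext b
    show aH ((bondEquiv F K).symm (bondEquiv F K b)) = aH b
    rw [Equiv.symm_apply_apply]
  have hιb : ∀ b : PBond (F.P K) 0, JetSup.equiv _ _ _ δ' (bondEquiv F K b) = aH b := fun b => by
    show aH ((bondEquiv F K).symm (bondEquiv F K b)) = aH b
    rw [Equiv.symm_apply_apply]
  have haRb : ∀ b : PBond (F.P K) 0, star (aH b) = aH b := fun b => by
    have h1 := congrFun haR b
    rwa [Pi.star_apply] at h1
  have hδR : ∀ b : PBond (F.P K) 0, star (JetSup.equiv _ _ _ δ' (bondEquiv F K b)) = JetSup.equiv _ _ _ δ' (bondEquiv F K b) := fun b => by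
    rw [hιb b]
    exact haRb b
  have hδtr : ∀ b : PBond (F.P K) 0, Matrix.trace (JetSup.equiv _ _ _ δ' (bondEquiv F K b)) = 0 := fun b => by rw [hιb b]; exact hatr b
  have hδQ : QTwS F n K h U₀ (fun b : PBond (F.P K) 0 => JetSup.equiv _ _ _ δ' (bondEquiv F K b)) = 0 := by rw [hι]; exact haQ
  -- `hCrit127` at the route direction `δ := (η·i) • ιδ′` (skew-Hermitian, traceless, in `ker QTwS`)
  have hsR : ∀ b', star (((((( eta F n K : ℝ) : ℂ)) * Complex.I) • fun b : PBond (F.P K) 0 => JetSup.equiv _ _ _ δ' (bondEquiv F K b)) b')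
      = -((((( eta F n K : ℝ) : ℂ)) * Complex.I) • fun b : PBond (F.P K) 0 => JetSup.equiv _ _ _ δ' (bondEquiv F K b)) b' ∧
      Matrix.trace (((((( eta F n K : ℝ) : ℂ)) * Complex.I) • fun b : PBond (F.P K) 0 => JetSup.equiv _ _ _ δ' (bondEquiv F K b)) b') = 0 := fun b' => by
    have hstarc : star ((((eta F n K : ℝ) : ℂ)) * Complex.I) = -((((eta F n K : ℝ) : ℂ)) * Complex.I) := by simp
    simp only [Pi.smul_apply]
    refine ⟨?_, ?_⟩
    · rw [star_smul, hδR b', hstarc, neg_smul]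
    · rw [Matrix.trace_smul, hδtr b', smul_zero]
  have hsQ : QTwS F n K h U₀ (((((eta F n K : ℝ) : ℂ)) * Complex.I) • fun b : PBond (F.P K) 0 => JetSup.equiv _ _ _ δ' (bondEquiv F K b)) = 0 := by
    rw [map_smul, hδQ, smul_zero]
  -- the field `A′ := A₁ + H₁f(Δ_L) B` read as ONE (115)-field: `ιA₁ + ι(H₁f B) = ι(A₁ + H₁f B)` by `rfl`
  have hfun : ((fun b : PBond (F.P K) 0 => JetSup.equiv _ _ _ A₁ (bondEquiv F K b))
        + (fun b : PBond (F.P K) 0 => JetSup.equiv _ _ _ (H1f F n K h c₀ cB a ΔL U₀ B) (bondEquiv F K b)))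
      = fun b : PBond (F.P K) 0 => JetSup.equiv _ _ _ (A₁ + H1f F n K h c₀ cB a ΔL U₀ B) (bondEquiv F K b) := by
    funext b
    rfl
  have hch := hchart δ' hδR hδtr hδQ
  have hxr := hXR δ' hδR hδtr hδQ
  have hcr := hCrit127 _ hsR hsQ
  rw [hfun] at hch hxr hcr ⊢
  have hmain := inner_toL2_residual_eq_zero_of_hCrit127_of_hasDerivAt_actionZ_field (c₀ := c₀) (Δx := Δx) U₀
    (A₁ + H1f F n K h c₀ cB a ΔL U₀ B) W Tc χ hδR (hZ δ' hδR hδtr hδQ) hch hxr hcr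
  rw [hι] at hmain
  exact hmain

/-- ★★ **S11's ROW `h128Δ`, TWO SLOTS, AT `U₀ ∈ 𝔘_k(ε₀)`** (sector rows discharged: ✓`QTwS_star_comm_of_regPr`, ✓`QTwS_traceless_of_regPr`, ✓`QTwS_scalar_of_regPr`).
[cite: Balaban1985Variational, (127)–(128) p.297, (84) p.290, (51) p.286; Balaban1985BackgroundPropagators, (3.13)–(3.15) p.393] -/
theorem exists_eq_adjoint_Qk_of_hCrit127_of_hasDerivAt_actionZ_twoSlot_regPr
    {ΔL : GaugeField (F.P K) 0 (Matrix.specialUnitaryGroup (Fin 2) ℂ) → (BondL2K ℂ 3 (periodsT3 F K) c₀ W₂ →ₗ[ℂ] BondL2K ℂ 3 (periodsT3 F K) c₀ W₂)}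
    {ε₀ e : ℝ} (hε₀ : 0 < ε₀) (he : 0 < e) (hWe : 10 ^ 9 * (F.L : ℝ) ^ 2 * e ≤ 1) (hWε : 10 ^ 12 * (F.L : ℝ) ^ 3 * ε₀ ≤ 1)
    (U₀ : GaugeField (F.P K) 0 (Matrix.specialUnitaryGroup (Fin 2) ℂ)) (hreg : RegPr F n K ε₀ U₀)
    (A₁ : Space115 (F.L : ℝ) (((F.L : ℝ)⁻¹) ^ (K - n)) (fun _ : Bond 3 (periodsT3 F K) => K - n) (fun _ : Bond 3 (periodsT3 F K) × Fin 3 => K - n)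
      (nabla115 (((F.L : ℝ)⁻¹) ^ (K - n)) (bgOfCfg F K U₀)))
    (W : Space115 (F.L : ℝ) (((F.L : ℝ)⁻¹) ^ (K - n)) (fun _ : Bond 3 (periodsT3 F K) => K - n) (fun _ : Bond 3 (periodsT3 F K) × Fin 3 => K - n)
        (nabla115 (((F.L : ℝ)⁻¹) ^ (K - n)) (bgOfCfg F K U₀)) →
      NegSize (F.L : ℝ) (((F.L : ℝ)⁻¹) ^ (K - n)) (fun _ : Bond 3 (periodsT3 F K) => K - n) 3 (Matrix (Fin 2) (Fin 2) ℂ))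
    (Tc : Space115 (F.L : ℝ) (((F.L : ℝ)⁻¹) ^ (K - n)) (fun _ : Bond 3 (periodsT3 F K) => K - n) (fun _ : Bond 3 (periodsT3 F K) × Fin 3 => K - n)
        (nabla115 (((F.L : ℝ)⁻¹) ^ (K - n)) (bgOfCfg F K U₀)) →
      Space115 (F.L : ℝ) (((F.L : ℝ)⁻¹) ^ (K - n)) (fun _ : Bond 3 (periodsT3 F K) => K - n) (fun _ : Bond 3 (periodsT3 F K) × Fin 3 => K - n)
        (nabla115 (((F.L : ℝ)⁻¹) ^ (K - n)) (bgOfCfg F K U₀)))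
    (B : PBond (F.P n) 0 → Matrix (Fin 2) (Fin 2) ℂ)
    (χ : (PBond (F.P K) 0 → Matrix (Fin 2) (Fin 2) ℂ) → (PBond (F.P K) 0 → Matrix (Fin 2) (Fin 2) ℂ))
    (hZ : ∀ δ' : Space115 (F.L : ℝ) (((F.L : ℝ)⁻¹) ^ (K - n)) (fun _ : Bond 3 (periodsT3 F K) => K - n) (fun _ : Bond 3 (periodsT3 F K) × Fin 3 => K - n)
        (nabla115 (((F.L : ℝ)⁻¹) ^ (K - n)) (bgOfCfg F K U₀)),
      (∀ b : PBond (F.P K) 0, star (JetSup.equiv _ _ _ δ' (bondEquiv F K b)) = JetSup.equiv _ _ _ δ' (bondEquiv F K b)) →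
      (∀ b : PBond (F.P K) 0, Matrix.trace (JetSup.equiv _ _ _ δ' (bondEquiv F K b)) = 0) →
      QTwS F n K h U₀ (fun b : PBond (F.P K) 0 => JetSup.equiv _ _ _ δ' (bondEquiv F K b)) = 0 →
      HasDerivAt (fun t : ℝ => actionZ Tsh (((F.L : ℝ)⁻¹) ^ (K - n)) 3
        ((LinearMap.toContinuousLinearMap (Matrix.traceLinearMap (Fin 2) ℂ ℂ) : Matrix (Fin 2) (Fin 2) ℂ →L[ℂ] ℂ) : Matrix (Fin 2) (Fin 2) ℂ →ₗ[ℂ] ℂ)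
        (prodCfg (Ucur (bgOfCfg F K U₀)) (((F.L : ℝ)⁻¹) ^ (K - n)) (curL (flat115 (Tc (A₁ + H1f F n K h c₀ cB a ΔL U₀ B + (t : ℂ) • δ'))))))
      (pair27 (LinearMap.toContinuousLinearMap (Matrix.traceLinearMap (Fin 2) ℂ ℂ)) (Jcur (bgOfCfg F K U₀) : NegSize (F.L : ℝ) (((F.L : ℝ)⁻¹) ^ (K - n)) (fun _ : Bond 3 (periodsT3 F K) => K - n) 3 (Matrix (Fin 2) (Fin 2) ℂ)) (flat115 δ')
        + pair27 (LinearMap.toContinuousLinearMap (Matrix.traceLinearMap (Fin 2) ℂ ℂ))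
            (currentCLM frobEquiv (fun _ : Bond 3 (periodsT3 F K) × Fin 3 => K - n) (nabla115 (((F.L : ℝ)⁻¹) ^ (K - n)) (bgOfCfg F K U₀)) (Δx U₀) (A₁ + H1f F n K h c₀ cB a ΔL U₀ B))
            (flat115 δ')
        + pair27 (LinearMap.toContinuousLinearMap (Matrix.traceLinearMap (Fin 2) ℂ ℂ)) (W (A₁ + H1f F n K h c₀ cB a ΔL U₀ B)) (flat115 δ')) 0)
    (hchart : ∀ δ' : Space115 (F.L : ℝ) (((F.L : ℝ)⁻¹) ^ (K - n)) (fun _ : Bond 3 (periodsT3 F K) => K - n) (fun _ : Bond 3 (periodsT3 F K) × Fin 3 => K - n)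
        (nabla115 (((F.L : ℝ)⁻¹) ^ (K - n)) (bgOfCfg F K U₀)),
      (∀ b : PBond (F.P K) 0, star (JetSup.equiv _ _ _ δ' (bondEquiv F K b)) = JetSup.equiv _ _ _ δ' (bondEquiv F K b)) →
      (∀ b : PBond (F.P K) 0, Matrix.trace (JetSup.equiv _ _ _ δ' (bondEquiv F K b)) = 0) →
      QTwS F n K h U₀ (fun b : PBond (F.P K) 0 => JetSup.equiv _ _ _ δ' (bondEquiv F K b)) = 0 →
      ∀ᶠ t : ℝ in nhds 0,
        ((((eta F n K : ℝ) : ℂ)) * Complex.I) • (fun b : PBond (F.P K) 0 => JetSup.equiv _ _ _ (Tc (A₁ + H1f F n K h c₀ cB a ΔL U₀ B + (t : ℂ) • δ')) (bondEquiv F K b))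
          = χ (((((eta F n K : ℝ) : ℂ)) * Complex.I) • ((fun b : PBond (F.P K) 0 => JetSup.equiv _ _ _ A₁ (bondEquiv F K b))
                + (fun b : PBond (F.P K) 0 => JetSup.equiv _ _ _ (H1f F n K h c₀ cB a ΔL U₀ B) (bondEquiv F K b)))
              + (t : ℂ) • (((((eta F n K : ℝ) : ℂ)) * Complex.I) • fun b : PBond (F.P K) 0 => JetSup.equiv _ _ _ δ' (bondEquiv F K b))))
    (hXR : ∀ δ' : Space115 (F.L : ℝ) (((F.L : ℝ)⁻¹) ^ (K - n)) (fun _ : Bond 3 (periodsT3 F K) => K - n) (fun _ : Bond 3 (periodsT3 F K) × Fin 3 => K - n)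
        (nabla115 (((F.L : ℝ)⁻¹) ^ (K - n)) (bgOfCfg F K U₀)),
      (∀ b : PBond (F.P K) 0, star (JetSup.equiv _ _ _ δ' (bondEquiv F K b)) = JetSup.equiv _ _ _ δ' (bondEquiv F K b)) →
      (∀ b : PBond (F.P K) 0, Matrix.trace (JetSup.equiv _ _ _ δ' (bondEquiv F K b)) = 0) →
      QTwS F n K h U₀ (fun b : PBond (F.P K) 0 => JetSup.equiv _ _ _ δ' (bondEquiv F K b)) = 0 →
      ∀ᶠ t : ℝ in nhds 0, ∀ b' : PBond (F.P K) 0,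
        (((-Complex.I) • χ (((((eta F n K : ℝ) : ℂ)) * Complex.I) • ((fun b : PBond (F.P K) 0 => JetSup.equiv _ _ _ A₁ (bondEquiv F K b))
                + (fun b : PBond (F.P K) 0 => JetSup.equiv _ _ _ (H1f F n K h c₀ cB a ΔL U₀ B) (bondEquiv F K b)))
              + (t : ℂ) • (((((eta F n K : ℝ) : ℂ)) * Complex.I) • fun b : PBond (F.P K) 0 => JetSup.equiv _ _ _ δ' (bondEquiv F K b)))) b').IsHermitian ∧
        Matrix.trace (((-Complex.I) • χ (((((eta F n K : ℝ) : ℂ)) * Complex.I) • ((fun b : PBond (F.P K) 0 => JetSup.equiv _ _ _ A₁ (bondEquiv F K b))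
                + (fun b : PBond (F.P K) 0 => JetSup.equiv _ _ _ (H1f F n K h c₀ cB a ΔL U₀ B) (bondEquiv F K b)))
              + (t : ℂ) • (((((eta F n K : ℝ) : ℂ)) * Complex.I) • fun b : PBond (F.P K) 0 => JetSup.equiv _ _ _ δ' (bondEquiv F K b)))) b') = 0)
    (hCrit127 : ∀ δ : PBond (F.P K) 0 → Matrix (Fin 2) (Fin 2) ℂ, (∀ b', star (δ b') = -δ b' ∧ (δ b').trace = 0) → QTwS F n K h U₀ δ = 0 →
      deriv (fun t : ℝ => wilsonAction4 (emb15 U₀ (expHermField (fun b' : PBond (F.P K) 0 => (-Complex.I) •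
        (χ (((((eta F n K : ℝ) : ℂ)) * Complex.I) • ((fun b : PBond (F.P K) 0 => JetSup.equiv _ _ _ A₁ (bondEquiv F K b))
            + (fun b : PBond (F.P K) 0 => JetSup.equiv _ _ _ (H1f F n K h c₀ cB a ΔL U₀ B) (bondEquiv F K b)))
          + (t : ℂ) • δ)) b')))) 0 = 0)
    (hXtr : ∀ b : PBond (F.P K) 0, Matrix.trace ((toL2 F K c₀).symm
      (Δx U₀ (toL2 F K c₀ ((fun b : PBond (F.P K) 0 => JetSup.equiv _ _ _ A₁ (bondEquiv F K b))
          + (fun b : PBond (F.P K) 0 => JetSup.equiv _ _ _ (H1f F n K h c₀ cB a ΔL U₀ B) (bondEquiv F K b))))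
        + (funEquiv frobEquiv (fun _ : Bond 3 (periodsT3 F K) => c₀)).symm
            (NegSup.equiv _ _ (Jcur (L := (F.L : ℝ)) (η := ((F.L : ℝ)⁻¹) ^ (K - n)) (lev₀ := fun _ : Bond 3 (periodsT3 F K) => K - n) (bgOfCfg F K U₀))
              + NegSup.equiv _ _ (W (A₁ + H1f F n K h c₀ cB a ΔL U₀ B)))) b) = 0) :
    ∃ μ : WL2 ℂ (fun _ : PBond (F.P n) 0 => cB) W₂,
      Δx U₀ (toL2 F K c₀ ((fun b : PBond (F.P K) 0 => JetSup.equiv _ _ _ A₁ (bondEquiv F K b))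
          + (fun b : PBond (F.P K) 0 => JetSup.equiv _ _ _ (H1f F n K h c₀ cB a ΔL U₀ B) (bondEquiv F K b))))
        + (funEquiv frobEquiv (fun _ : Bond 3 (periodsT3 F K) => c₀)).symm
            (NegSup.equiv _ _ (Jcur (L := (F.L : ℝ)) (η := ((F.L : ℝ)⁻¹) ^ (K - n)) (lev₀ := fun _ : Bond 3 (periodsT3 F K) => K - n) (bgOfCfg F K U₀))
              + NegSup.equiv _ _ (W (A₁ + H1f F n K h c₀ cB a ΔL U₀ B)))
      = LinearMap.adjoint (Qk F n K h c₀ cB U₀) μ :=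
  exists_eq_adjoint_Qk_of_hCrit127_of_hasDerivAt_actionZ_twoSlot U₀ (QTwS_star_comm_of_regPr F h hε₀ he hWe hWε U₀ hreg) (QTwS_traceless_of_regPr F h hε₀ he hWe hWε U₀ hreg)
    (QTwS_scalar_of_regPr F h hε₀ hWε U₀ hreg) A₁ W Tc B χ hZ hchart hXR hCrit127 hXtr

end Summit.QuantumFields.YangMills.Theorems.Prop7Eq128AtMemberOfCrit127TwoSlot

end
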